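import Literature.NumberTheory.EllipticCurves.Kobayashi2003.CyclotomicTowerSignedSelmer
import Literature.NumberTheory.EllipticCurves.IwasawaAlgebraInvolution
import Mathlib.NumberTheory.Cyclotomic.Basic
import HarnessLib

/-!
# B. D. Kim, MRL 15 (2008): the ALGEBRAIC FUNCTIONAL EQUATION of Kobayashi's signed Selmer groups at a
# supersingular prime — `Char X^±(E/ℚ_∞)` and `Char X^±(E/ℚ(μ_{p^∞}))^η` (`η² = 1`) are fixed by the
# Iwasawa involution `ι` (two named facts on the tree's objects `SignedSelmerDualData` /
# `EtaSignedSelmerDualData`, ideal form; proved corollaries)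

Topic `Literature/NumberTheory/EllipticCurves`, cluster `Kim2008` (namespace = path). Typed by the
definition typer `bsd-stepL-defn-ty1` (g19) at the request of cell `bsd-potss` (planner g27, TYPER
REQUEST «T-AFE-KIM-311», 2026-08-28; support item stmt-BirchSwinnertonDyer-26766
`QuadraticBranchSignedControl.PlusSignedDualsInvolInvariant`, "displayed until typed") and cc'd to the
ARM-P reading programme `bsd-cited`. HONEST FRAMING: the Birch–Swinnerton-Dyer conjecture is not
proved by any of this; these are two PUBLISHED THEOREMS read on the tree's own objects, plus their
one-line consequences, proved. No `sorry`; no instance, no notation; nothing about `p`-adic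
`L`-functions is asserted.

## Source, verbatim (Byoung Du Kim, *The algebraic functional equation of an elliptic curve at
## supersingular primes*, Math. Res. Lett. 15 (2008), no. 1, 83–94 [KimBD2008MRL]; held copy
## `paper:doi-10-4310-mrl-2008-v15-n1-a8`, file `p00NN` = printed page `82 + NN`; re-read by this
## seat 2026-08-28)

p. 83 (§1): "We let `E` be an elliptic curve defined over `ℚ` and let `p > 3` be a prime at which `E`
has good supersingular reduction. We let `K` be an abelian extension of `ℚ` such that `[K : ℚ]` is
prime to `p` and `p` is unramified over `K/ℚ`. Let `K_∞` be the cyclotomic `ℤ_p`-extension of `K`. We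
define `Sel_p^−(E/K_∞)` following [5], [2], and [4]. … Let `g = [K : ℚ]`, `O = ℤ_p[μ_g]` … Let
`Γ = Gal(K_∞/K)`, `Λ = ℤ_p[[Γ]]` … We identify `Λ_O` with the integral power series ring `O[[X]]` by
identifying a topological generator `γ` of `Γ` with `1 + X`. … following Greenberg's idea we will
show **(1)** `(Sel_p^−(E/K_∞) ⊗ O)^∨ ∼ (Sel_p^−(E/K_∞)^ι ⊗ O)^∨` where `∼` is a
`O[[Gal(K_∞/ℚ)]]`-pseudo-isomorphism (a homomorphism with finite kernel and cokernel) and `ι` is the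
standard involution given by `g → g^{−1}` for any `g ∈ Gal(K_∞/ℚ)`. This implies that the
characteristic ideal `(a) ⊂ Λ` of the Pontryagin dual of `Sel_p^−(E/K_∞)` is nonzero and satisfies
the algebraic functional equation `(a) = (a^ι)`."
p. 84: "when `K = ℚ(μ_p)` or `p` splits completely over `K/ℚ`, we have the plus norm subgroups as
constructed in [5] and [2], and we can prove the algebraic functional equation for the plus Selmer
groups without modifying our technique. … We let `Δ = Gal(K/ℚ)` and `ℚ_∞ = K_∞^Δ`. … Since `[K : ℚ]`
is prime to `p`, we have the decomposition `Sel_p^−(E/K_∞) ⊗ O ≅ ⊕_η η(Sel_p^−(E/K_∞) ⊗ O)` where `η`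
runs over all characters of `Δ`. Thus to show `Sel_p^−(E/K_∞) ⊗ O ∼ Sel_p^−(E/K_∞)^ι ⊗ O` as
`O[[Gal(K_∞/ℚ)]]`-modules, it is enough to show `η(Sel_p^−(E/K_∞) ⊗ O) ∼ η̄(Sel_p^−(E/K_∞)^ι ⊗ O)`
as `Λ_O`-modules for each character `η` of `Δ`. … Remark 1.1. … we let `M^η` denote the submodule of
`M` where every `σ ∈ Δ` acts as multiplication by `η(σ)`. In fact, we can identify `M^η = ηM`".
p. 92: "We define … the minus Selmer group `Sel_p^−(E/K_∞) := ker( H¹(K_Σ/K_∞, E[p^∞]) →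
∏_w H¹(K_{∞,w}, E[p^∞]) / H_F^1(K_{∞,w}, E[p^∞]) )` … (compare this definition with that of [5],
[2], and [4])." p. 93: "**Proposition 3.9.** `Sel_p^−(E/K_∞)` is `Λ`-cotorsion. … **Theorem 3.10.**
Let `X = (Sel_p^−(E/K_∞) ⊗ O)^∨`. For each character `η` of `Δ` we have `X^η ∼ X^{ι,η̄}` as
`Λ_O`-modules, or equivalently `X ∼ X^ι` as `O[[Gal(K_∞/ℚ)]]`-modules. Consequently we have the
following: let `(a) ⊂ Λ` be the characteristic ideal of `Sel_p^−(E/K_∞)^∨`. We have `(a) = (a^ι)`.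
… However, Kobayashi's plus/minus norm subgroups for `ℚ(μ_{p^∞})` have this property. We can apply
our technique to both `±`-Selmer groups with little difficulty to obtain the following.
**Theorem 3.11.** We have `Sel_p^±(E/ℚ(μ_{p^∞}))^∨ ∼ Sel_p^±(E/ℚ(μ_{p^∞}))^{∨,ι}` where `∼` is a
pseudoisomorphism for `ℤ_p[[Gal(ℚ(μ_{p^∞})/ℚ)]]`-modules. Iovita and Pollack's plus/minus norm
subgroups also work well under the following condition: The prime `p` splits completely over
`K/ℚ`. … Assuming this condition we can prove a similar result. **Theorem 3.12.** We have
`(Sel_p^±(E/K_∞) ⊗ O)^∨ ∼ (Sel_p^±(E/K_∞)^ι ⊗ O)^∨`." ([5] = [Kobayashi2003], [2] = Iovita–Pollack,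
[4] = B. D. Kim, Compositio 143 (2007), [1] = [Greenberg1989].)

Secondary restatement (A. Lei, G. Ponsinet, Ann. Math. Québec 41 (2017) [LeiPonsinet2017], §1, held
copy `paper:arxiv-1601.04999` chunk p0003 L4–L16; `F` abelian over `ℚ`, `[F : ℚ]` prime to `p`,
primes above `p` unramified, `F_∞` its cyclotomic `ℤ_p`-extension): "This result has been generalized
to elliptic curves with supersingular reduction at `p` by Kim [kim08]. That is,
`Sel_p^±(E/F_∞) ∼ Sel_p^±(E/F_∞)^ι`, where `E` is an elliptic curve with `a_p(E) = 0` and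
`Sel_p^±(E/F_∞)` are Kobayashi's plus and minus Selmer groups from [kobayashi03]."

## Transcription (tree vocabulary only; nothing re-declared)

* `E/ℚ` = a globally minimal `V : WeierstrassCurve ℚ` (`[V.IsElliptic] [V.IsGloballyMinimal]`, the
  frame of the tree's K8 rows); "`p > 3` … good supersingular reduction" = `3 < p`,
  `V.HasGoodReductionAtPrime p`, `V.frobeniusTrace p = 0` (for `p ≥ 5`, good supersingular ⟺ good with
  `a_p = 0` by the Hasse bound `|a_p| ≤ 2√p < p`; this is the encoding of the Kobayashi files and of
  the K8 rows); the Iwasawa involution `ι` = `IwasawaAlgebra.invol p : Λ →ₐ[ℤ_p] Λ`,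
  `T ↦ (1 + T)⁻¹ − 1` (file `IwasawaAlgebraInvolution`), so "`(a) = (a^ι)`" reads
  `Ideal.map (IwasawaAlgebra.invol p) (Char X) = Char X`.
* §1 (`K = ℚ`): `K_∞ = ℚ_∞` is the cyclotomic `κ : ZpExtension ℚ p` (`κ.IsCyclotomic`) with a
  topological generator `γ` ("identifying a topological generator `γ` of `Γ` with `1 + X`"), `O = ℤ_p`
  (`g = 1`), `Δ = 1`; `Sel_p^±(E/ℚ_∞)` "as constructed in [5]" is the tree's
  `Kobayashi2003.signedSelmerInfty V κ ε` (Kobayashi Def. 1.1, sign `ε : ℤˣ`) and `X = Sel^∨` with its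
  `Λ`-structure is a datum `D : Kobayashi2003.SignedSelmerDualData V κ γ ε`, `Char X = D.charIdeal`.
* §2 (`K = ℚ(μ_p)`, Thm. 3.11): `K₀ = ℚ(μ_p)` (`IsCyclotomicExtension {p} ℚ K₀`, `galRange K₀` normal),
  `K_∞ = K₀·ℚ_∞ = ℚ(μ_{p^∞})` = the tower of `Kobayashi2003.towerSignedSelmerInfty V κ K₀ ℚ_[p] ε`
  (Kobayashi §2 / Def. 2.1, the objects "for `ℚ(μ_{p^∞})`" of Thm. 3.11), `η : Γ_ℚ →* ℤˣ` trivial on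
  `galRange K₀` = a `{±1}`-valued character of `Δ = Gal(ℚ(μ_p)/ℚ)` (so `η̄ = η`: the trivial
  character and `ω^{(p−1)/2}`), `X^η = (Sel^±(E/ℚ(μ_{p^∞}))^η)^∨` with `T ↔ γ − 1`, `γ ∈ Gal(ℚ̄/K₀)` =
  a datum `D : Kobayashi2003.EtaSignedSelmerDualData V κ K₀ ℚ_[p] η γ ε`, `Char X^η = D.charIdeal` —
  binder for binder the frame of the tree's `Kobayashi2003.thm22_etaSignedSelmerDual_finite_torsion`.

## Flags (nothing hidden)

* `K08-ideal-form` (CONCLUSION): the theorems are PRINTED as pseudo-isomorphisms `X ∼ X^ι`; the facts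
  below state their characteristic-ideal consequence `ι(Char X) = Char X`, which is the form the source
  itself draws ("This implies that the characteristic ideal `(a)` … satisfies the algebraic functional
  equation `(a) = (a^ι)`", p. 83; "Consequently … `(a) = (a^ι)`", Thm. 3.10) — WEAKER than the
  pseudo-isomorphism (`Char` is a pseudo-isomorphism invariant, tree
  `Module.charIdeal_eq_of_arePseudoIsomorphic`, and `Char(X^ι) = ι(Char X)`). The statement
  `ι(Char X) = Char X` is insensitive to the choice between the two `Λ`-structures on a Pontryagin
  dual (contragredient vs. pre-composition, which differ exactly by `ι`; the tree's data use
  pre-composition, `toDual_T_smul`), so no convention flag is needed. Not typed: the pseudo-isomorphism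
  itself (the tree has no `ι`-twisted module `X^ι` in `Literature/`; TODO(general form)).
* `K08-K-eq-Q` (SCOPE of §1): Thm. 3.12 (and, for the sign `−`, Thm. 3.10 and eq. (1)) is printed
  for every abelian `K/ℚ` with `[K : ℚ]` prime to `p`, `p` unramified in `K` and (3.12) `p` split
  completely in `K`, with `O = ℤ_p[μ_{[K:ℚ]}]`-coefficients and `ℤ_p[[Gal(K_∞/ℚ)]]`-equivariance; §1
  types the case `K = ℚ` only (`O = ℤ_p`, `K_∞ = ℚ_∞`, the plus/minus subgroups "as constructed in
  [5]" = Kobayashi's Def. 1.1), which is also the restatement of [LeiPonsinet2017] §1 at `F = ℚ`.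
  TODO(general form): general `K`.
* `K08-eta-pm1` (SCOPE of §2): Thm. 3.11 is a pseudo-isomorphism of `ℤ_p[[Δ × Γ]]`-modules; by the
  source's own equivalence ("`X^η ∼ X^{ι,η̄}` as `Λ_O`-modules, or equivalently `X ∼ X^ι` as
  `O[[Gal(K_∞/ℚ)]]`-modules", Thm. 3.10; mechanism p. 84, `p ∤ |Δ|`) it is the family of
  `Λ`-pseudo-isomorphisms `X^η ∼ (X^{η̄})^ι`, `η` running over the characters of `Δ` (`O = ℤ_p` here:
  `μ_{p−1} ⊂ ℤ_p`). §2 types the components with `η̄ = η`, i.e. the `{±1}`-valued `η` (the only ones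
  the tree's `towerSignedSelmerInftyEta` carries — its own TODO(general form)), for which the
  statement is self-dual: `ι(Char X^η) = Char X^η`. For `η² = 1` the two conventions for the
  `Δ`-action on a dual give the same component (module docstring of `CyclotomicTowerSignedSelmer`).
* `K08-object`: Kim's `Sel_p^±` is defined directly over `K_∞` with the signed condition
  `H_P ⊗ O`, `H_P = ∪_n Ê^±(k_n) ⊗ ℚ_p/ℤ_p` at `P ∣ p` and the unramified condition elsewhere ("compare
  this definition with that of [5], [2], and [4]", p. 92), and Thm. 3.11/3.12 refer to "Kobayashi's" /
  "Iovita and Pollack's plus/minus norm subgroups"; the tree's objects are Kobayashi's Def. 1.1 /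
  Def. 2.1 direct limits `lim→_n Sel^±(E/K_n)`. The facts are stated on the tree's (Kobayashi's)
  objects, as the source's own cross-reference intends; no comparison lemma is asserted here.
* `K08-ap`: the source's "good supersingular at `p > 3`" is typed `3 < p`, good reduction, `a_p = 0`
  (equivalent for `p ≥ 5`). Cotorsion is NOT a hypothesis (the source proves it, Prop. 3.9; over
  `ℚ(μ_{p^∞})` it is [Kobayashi2003] Thm. 2.2, tree fact `thm22_etaSignedSelmerDual_finite_torsion`).

## What is here / what is not

* §1 `thm312_signedSelmerDual_charIdeal_map_invol` (named fact, `K = ℚ`, both signs) and its proved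
  corollaries: the `5 ≤ p` / sign-`+` reading `…plus_of_five_le` (= the `D`-half of the K8 support
  item 26766, by name), the generator form `…exists_unit_invol_generator` (`ι f = u·f`, `u ∈ Λˣ`).
* §2 `thm311_etaSignedSelmerDual_charIdeal_map_invol` (named fact, `η² = 1`, both signs) and its
  `η = 1` / `5 ≤ p` readings.
* NOT here: the `DF`-half of item 26766 (the plus Selmer group of `E/F`, `F = ℚ(√p*)`, over `F_∞` in
  the tree's Def. 1.1 currency `signedSelmerInfty (V.baseChange F) κF 1`): `p` is RAMIFIED in `F`, so
  neither Thm. 3.10/3.12 (which need `p` unramified / split in `K`) nor [LeiPonsinet2017] covers it as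
  printed; it is the `{1, η_F}`-part of Thm. 3.11 only AFTER the prime-to-`p` descent
  `Sel^+(E/F_∞) = Sel^+(E/ℚ(μ_{p^∞}))^{Gal(ℚ(μ_{p^∞})/F_∞)}` and the identification of the tree's
  Def. 1.1 plus condition over the ramified tower `F_{n,𝔭}` with Kobayashi's over `ℚ_p(μ_{p^{n+1}})`
  — routine, NOT verbatim in print (the item's own "why it might fail"), and not asserted here.
  Not here either: Pollack's analytic functional equation (Thm. 5.13, tree `Sprung2017`/`Pollack`
  files), the main conjecture, any `_holds` (the proofs are Greenberg's Iwasawa-theoretic criterion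
  Prop. 3.6 + Poitou–Tate duality + Kato/Rohrlich; none of it is in Mathlib).

## References

* [KimBD2008MRL] B. D. Kim, Math. Res. Lett. 15 (2008), no. 1, 83–94: §1 p. 83 (standing hypotheses,
  eq. (1), "`(a) = (a^ι)`"), p. 84 (`η`-decomposition, Remark 1.1), p. 92 (definition of `Sel_p^−`),
  Prop. 3.9, Thm. 3.10, Thm. 3.11, Thm. 3.12 (p. 93).
* [Kobayashi2003] S. Kobayashi, Invent. Math. 152 (2003): Def. 1.1 (p. 2), §2 / Def. 2.1 (pp. 4–5), §4
  p. 8 (`η`-components), Thm. 2.2 — the objects (tree files `Kobayashi2003/SignedSelmer`,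
  `Kobayashi2003/CyclotomicTowerSignedSelmer`, facts `Kobayashi2003/SignedSelmerEtaComponentFacts`).
* [LeiPonsinet2017] A. Lei, G. Ponsinet, Ann. Math. Québec 41 (2017) 155–167, §1 (restatement of Kim's
  theorem over `F_∞`).
* [Greenberg1989] R. Greenberg, Adv. Stud. Pure Math. 17 (1989) — Kim's [1] (the criterion Prop. 3.6);
  the ordinary analogue in the tree: `Greenberg1999_thm114_charIdeal_iota_invariant`,
  `Greenberg1999/CharIdealInvolutionIdealForm` (same ideal currency `Ideal.map (invol p) … = …`).
* [Washington1997] §13.2 (`Λ`, pseudo-isomorphism, characteristic ideal); tree `IwasawaAlgebra`,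
  `IwasawaAlgebraInvolution`.
-/

noncomputable section

open scoped Classical

open WeierstrassCurve Field Literature.NumberTheory.EllipticCurves
  Literature.NumberTheory.GaloisRepresentations ZpExtension
  Literature.NumberTheory.EllipticCurves.Kobayashi2003

namespace Literature.NumberTheory.EllipticCurves.Kim2008

/-! ## §1 Over `ℚ_∞` (`K = ℚ`): Thm. 3.12 — and Thm. 3.10 / eq. (1) for the sign `−` — both signs -/

/-- **B. D. Kim 2008, Thm. 3.12 at `K = ℚ` (for the sign `−` also Thm. 3.10 and eq. (1)): the
algebraic functional equation of Kobayashi's signed Selmer groups over `ℚ_∞`, ideal form.** As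
printed (p. 93): "Theorem 3.12. We have `(Sel_p^±(E/K_∞) ⊗ O)^∨ ∼ (Sel_p^±(E/K_∞)^ι ⊗ O)^∨`" for `K/ℚ`
abelian, `[K : ℚ]` prime to `p`, `p` unramified and split completely in `K` (p. 83, p. 93), "where `∼`
is a … pseudo-isomorphism … and `ι` is the standard involution given by `g → g^{−1}` … This implies
that the characteristic ideal `(a) ⊂ Λ` of the Pontryagin dual … satisfies the algebraic functional
equation `(a) = (a^ι)`" (p. 83); Thm. 3.10 (sign `−`, `p` unramified in `K`): "Consequently … let
`(a) ⊂ Λ` be the characteristic ideal of `Sel_p^−(E/K_∞)^∨`. We have `(a) = (a^ι)`." READ AT `K = ℚ`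
(`O = ℤ_p`, `K_∞ = ℚ_∞`, `Δ = 1`; the plus/minus subgroups "as constructed in [5]" = Kobayashi's
Def. 1.1): for `V/ℚ` globally minimal elliptic, a prime `p > 3` of good supersingular reduction
(`3 < p`, good, `a_p = 0`), the cyclotomic `ℤ_p`-extension `κ` of `ℚ` with a topological generator
`γ`, a sign `ε`, and ANY Pontryagin-dual datum `D` of `Sel^ε(V/ℚ_∞)` (`Kobayashi2003.SignedSelmerDualData`):
the characteristic ideal `Char X^ε(V/ℚ_∞) = D.charIdeal ⊆ Λ = ℤ_p⟦T⟧` is FIXED by the Iwasawa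
involution `ι : T ↦ (1+T)⁻¹ − 1`, `Ideal.map (IwasawaAlgebra.invol p) D.charIdeal = D.charIdeal`.
Flags `K08-ideal-form`, `K08-K-eq-Q`, `K08-object`, `K08-ap` (module docstring). Also the
restatement of [LeiPonsinet2017] §1 at `F = ℚ`. Named fact (D-0014); nothing asserted; no `_holds`.
TODO(general form): abelian `K` with `p ∤ [K : ℚ]`, `p` unramified (and split, for `+`), with
`O`-coefficients and `ℤ_p[[Gal(K_∞/ℚ)]]`-equivariance; the pseudo-isomorphism `X ∼ X^ι` itself.
[cite: KimBD2008MRL, Thm. 3.12 and Thm. 3.10 (p. 93), §1 eq. (1) and "(a) = (a^ι)" (p. 83)]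
[cite: LeiPonsinet2017, §1 (restatement, `F = ℚ`)] -/
def thm312_signedSelmerDual_charIdeal_map_invol : Prop :=
  ∀ (V : WeierstrassCurve ℚ) [V.IsElliptic] [V.IsGloballyMinimal] (p : ℕ) [Fact p.Prime],
    3 < p → V.HasGoodReductionAtPrime p → V.frobeniusTrace p = 0 →
  ∀ (κ : ZpExtension ℚ p) (γ : absoluteGaloisGroup ℚ), κ.IsCyclotomic → κ.IsTopGenerator γ →
  ∀ (ε : ℤˣ) (D : SignedSelmerDualData V κ γ ε),
    Ideal.map (IwasawaAlgebra.invol p) D.charIdeal = D.charIdeal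

/-- **The `D`-half of the K8 support item `PlusSignedDualsInvolInvariant` (stmt-…-26766), BY NAME from
Thm. 3.12 at `K = ℚ`**: in the frame of that item's first conjunct — `5 ≤ p`, good reduction,
`a_p = 0`, `κ` cyclotomic with topological generator `γ`, `D : SignedSelmerDualData V κ γ 1` (sign
`+`) — `D.charIdeal.map ι = D.charIdeal`. (`5 ≤ p → 3 < p`.)
[cite: KimBD2008MRL, Thm. 3.12 (p. 93) and §1 p. 83] -/
theorem thm312_signedSelmerDual_charIdeal_map_invol.plus_of_five_le
    (h : thm312_signedSelmerDual_charIdeal_map_invol)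
    (V : WeierstrassCurve ℚ) [V.IsElliptic] [V.IsGloballyMinimal] (p : ℕ) [Fact p.Prime]
    (hp : 5 ≤ p) (hgood : V.HasGoodReductionAtPrime p) (hap : V.frobeniusTrace p = 0)
    (κ : ZpExtension ℚ p) (γ : absoluteGaloisGroup ℚ) (hκ : κ.IsCyclotomic) (hγ : κ.IsTopGenerator γ)
    (D : SignedSelmerDualData V κ γ 1) :
    D.charIdeal.map (IwasawaAlgebra.invol p) = D.charIdeal :=
  h V p (by omega) hgood hap κ γ hκ hγ 1 D

/-- **Generator form of Thm. 3.12 at `K = ℚ`** ("`(a) = (a^ι)`" for a characteristic power series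
`a`): for every generator `f` of `Char X^ε(V/ℚ_∞)` there is a unit `u ∈ Λˣ` with `ι(f) = u · f` (`Λ`
is a domain; equal principal ideals have associated generators).
[cite: KimBD2008MRL, §1 p. 83 ("(a) = (a^ι)") and Thm. 3.12 (p. 93)] [cite: Washington1997, §13.2] -/
theorem thm312_signedSelmerDual_charIdeal_map_invol.exists_unit_invol_generator
    (h : thm312_signedSelmerDual_charIdeal_map_invol)
    (V : WeierstrassCurve ℚ) [V.IsElliptic] [V.IsGloballyMinimal] (p : ℕ) [Fact p.Prime]
    (hp : 3 < p) (hgood : V.HasGoodReductionAtPrime p) (hap : V.frobeniusTrace p = 0)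
    (κ : ZpExtension ℚ p) (γ : absoluteGaloisGroup ℚ) (hκ : κ.IsCyclotomic) (hγ : κ.IsTopGenerator γ)
    (ε : ℤˣ) (D : SignedSelmerDualData V κ γ ε)
    (f : IwasawaAlgebra p) (hf : D.charIdeal = Ideal.span {f}) :
    ∃ u : (IwasawaAlgebra p)ˣ, IwasawaAlgebra.invol p f = (u : IwasawaAlgebra p) * f := by
  have hmap := h V p hp hgood hap κ γ hκ hγ ε D
  rw [hf, Ideal.map_span, Set.image_singleton] at hmap
  -- `hmap : span {invol p f} = span {f}`
  obtain ⟨u, hu⟩ := Ideal.span_singleton_eq_span_singleton.mp hmap.symm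
  -- `hu : f * u = invol p f`
  exact ⟨u, by rw [← hu, mul_comm]⟩

/-! ## §2 Over `ℚ(μ_{p^∞})` (`K = ℚ(μ_p)`): Thm. 3.11 on the `η`-components with `η² = 1`, both signs -/

/-- **B. D. Kim 2008, Thm. 3.11, read on the `η`-components for the `{±1}`-valued characters `η` of
`Δ = Gal(ℚ(μ_p)/ℚ)` (the trivial character and `ω^{(p−1)/2}`), ideal form.** As printed (p. 93):
"Theorem 3.11. We have `Sel_p^±(E/ℚ(μ_{p^∞}))^∨ ∼ Sel_p^±(E/ℚ(μ_{p^∞}))^{∨,ι}` where `∼` is a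
pseudoisomorphism for `ℤ_p[[Gal(ℚ(μ_{p^∞})/ℚ)]]`-modules", equivalently (Thm. 3.10: "`X^η ∼ X^{ι,η̄}`
as `Λ_O`-modules, or equivalently `X ∼ X^ι` as `O[[Gal(K_∞/ℚ)]]`-modules"; p. 84) the
`Λ`-pseudo-isomorphisms `X^η ∼ (X^{η̄})^ι` for the characters `η` of `Δ`, whence, for `η̄ = η`,
`Char X^η = ι(Char X^η)` ("`(a) = (a^ι)`", p. 83). Frame = the tree's
`Kobayashi2003.thm22_etaSignedSelmerDual_finite_torsion`, with `p ≠ 2` sharpened to the source's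
`p > 3`: `K₀ = ℚ(μ_p)`, `η : Γ_ℚ →* ℤˣ` trivial on `Gal(ℚ̄/K₀)`, `V/ℚ` globally minimal with good
supersingular reduction at `p > 3` (`3 < p`, good, `a_p = 0`), `κ` the cyclotomic `ℤ_p`-extension of
`ℚ` with a topological generator `γ ∈ Gal(ℚ̄/K₀)`, a sign `ε`, ANY Pontryagin-dual datum `D` of
`Sel^ε(V/ℚ(μ_{p^∞}))^η` at the model `ℚ_[p]` (`Kobayashi2003.EtaSignedSelmerDualData`): the ideal
`Char X^ε(V/ℚ(μ_{p^∞}))^η = D.charIdeal ⊆ ℤ_p⟦T⟧` is FIXED by the Iwasawa involution,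
`Ideal.map (IwasawaAlgebra.invol p) D.charIdeal = D.charIdeal`. Flags `K08-ideal-form`, `K08-eta-pm1`,
`K08-object`, `K08-ap` (module docstring). Named fact (D-0014); nothing asserted; no `_holds`.
TODO(general form): all characters `η` of `Δ` (`Char X^η = ι(Char X^{η̄})`), and the
`ℤ_p[[Δ × Γ]]`-pseudo-isomorphism itself.
[cite: KimBD2008MRL, Thm. 3.11 with Thm. 3.10 ("equivalently") (p. 93), p. 84 (η-decomposition), §1 p. 83 ("(a) = (a^ι)")] -/
def thm311_etaSignedSelmerDual_charIdeal_map_invol : Prop :=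
  ∀ (p : ℕ) [Fact p.Prime] (K₀ : Type) [Field K₀] [NumberField K₀] [IsCyclotomicExtension {p} ℚ K₀]
    [(galRange (K := ℚ) K₀).Normal] (η : absoluteGaloisGroup ℚ →* ℤˣ),
    (∀ σ ∈ galRange (K := ℚ) K₀, η σ = 1) →
  ∀ (V : WeierstrassCurve ℚ) [V.IsElliptic] [V.IsGloballyMinimal],
    3 < p → V.HasGoodReductionAtPrime p → V.frobeniusTrace p = 0 →
  ∀ (κ : ZpExtension ℚ p) (γ : absoluteGaloisGroup ℚ),
    κ.IsCyclotomic → κ.IsTopGenerator γ → γ ∈ galRange (K := ℚ) K₀ →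
  ∀ (ε : ℤˣ) (D : EtaSignedSelmerDualData V κ K₀ ℚ_[p] η γ ε),
    Ideal.map (IwasawaAlgebra.invol p) D.charIdeal = D.charIdeal

/-- **Thm. 3.11 on the `Δ`-invariant (`η = 1`) component, sign `+`, at `p ≥ 5`** — the shape of the
K8 rows of cell `bsd-potss` (`5 ≤ p`, good, `a_p = 0`): for ANY dual datum `D` of
`Sel^+(V/ℚ(μ_{p^∞}))^Δ`, `D.charIdeal.map ι = D.charIdeal`.
[cite: KimBD2008MRL, Thm. 3.11 (p. 93), p. 84] -/
theorem thm311_etaSignedSelmerDual_charIdeal_map_invol.trivialEta_plus_of_five_le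
    (h : thm311_etaSignedSelmerDual_charIdeal_map_invol)
    (p : ℕ) [Fact p.Prime] (K₀ : Type) [Field K₀] [NumberField K₀] [IsCyclotomicExtension {p} ℚ K₀]
    [(galRange (K := ℚ) K₀).Normal]
    (V : WeierstrassCurve ℚ) [V.IsElliptic] [V.IsGloballyMinimal]
    (hp : 5 ≤ p) (hgood : V.HasGoodReductionAtPrime p) (hap : V.frobeniusTrace p = 0)
    (κ : ZpExtension ℚ p) (γ : absoluteGaloisGroup ℚ) (hκ : κ.IsCyclotomic) (hγ : κ.IsTopGenerator γ)
    (hγ₀ : γ ∈ galRange (K := ℚ) K₀)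
    (D : EtaSignedSelmerDualData V κ K₀ ℚ_[p] (1 : absoluteGaloisGroup ℚ →* ℤˣ) γ 1) :
    D.charIdeal.map (IwasawaAlgebra.invol p) = D.charIdeal :=
  h p K₀ 1 (fun _ _ => rfl) V (by omega) hgood hap κ γ hκ hγ hγ₀ 1 D

/-- **Generator form of Thm. 3.11 on an `η`-component (`η² = 1`)**: for every generator `f` of
`Char X^ε(V/ℚ(μ_{p^∞}))^η` there is `u ∈ Λˣ` with `ι(f) = u · f`.
[cite: KimBD2008MRL, Thm. 3.11 (p. 93), §1 p. 83 ("(a) = (a^ι)")] [cite: Washington1997, §13.2] -/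
theorem thm311_etaSignedSelmerDual_charIdeal_map_invol.exists_unit_invol_generator
    (h : thm311_etaSignedSelmerDual_charIdeal_map_invol)
    (p : ℕ) [Fact p.Prime] (K₀ : Type) [Field K₀] [NumberField K₀] [IsCyclotomicExtension {p} ℚ K₀]
    [(galRange (K := ℚ) K₀).Normal] (η : absoluteGaloisGroup ℚ →* ℤˣ)
    (hη : ∀ σ ∈ galRange (K := ℚ) K₀, η σ = 1)
    (V : WeierstrassCurve ℚ) [V.IsElliptic] [V.IsGloballyMinimal]
    (hp : 3 < p) (hgood : V.HasGoodReductionAtPrime p) (hap : V.frobeniusTrace p = 0)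
    (κ : ZpExtension ℚ p) (γ : absoluteGaloisGroup ℚ) (hκ : κ.IsCyclotomic) (hγ : κ.IsTopGenerator γ)
    (hγ₀ : γ ∈ galRange (K := ℚ) K₀) (ε : ℤˣ) (D : EtaSignedSelmerDualData V κ K₀ ℚ_[p] η γ ε)
    (f : IwasawaAlgebra p) (hf : D.charIdeal = Ideal.span {f}) :
    ∃ u : (IwasawaAlgebra p)ˣ, IwasawaAlgebra.invol p f = (u : IwasawaAlgebra p) * f := by
  have hmap := h p K₀ η hη V hp hgood hap κ γ hκ hγ hγ₀ ε D
  rw [hf, Ideal.map_span, Set.image_singleton] at hmap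
  obtain ⟨u, hu⟩ := Ideal.span_singleton_eq_span_singleton.mp hmap.symm
  exact ⟨u, by rw [← hu, mul_comm]⟩

end Literature.NumberTheory.EllipticCurves.Kim2008

end
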